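import Summits.AtomisticToContinuum.HydrodynamicLimit.Theorems.RelayRaceLocalityNearConstantShortTimeHLTiltL2Assembly
import Summits.AtomisticToContinuum.HydrodynamicLimit.Theorems.RelayRaceLocalityNearConstantShortTimeHLReductionPX
import Summits.AtomisticToContinuum.HydrodynamicLimit.Theorems.RelayRaceLocalityNearConstantShortTimeHLDynamicPX
import HarnessLib

/-!
# Crux `NearConstantShortTimeHL` (stmt-AtomisticToContinuum-12502), line `small-tilt-domination`, skeleton v24 (lead c9):
# the ENDGAME UNDER THE INTEGRATED EXPONENTIAL CAP — the crux from the re-typed closure K-stubs, the packing cap and super-exponential velocity tails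

Support file (`--supports stmt-AtomisticToContinuum-12502`). Composition of the landed pieces of skeleton v24: level 0 `stub_reductionPX` (`…ReductionPX`)
∘ level 1 `stub_dynamicPX` (`…DynamicPX`) through the means-pin dock and the entropy-to-LLN step, with the statics side of the line closed
(`…TiltL2Assembly`). Compared with v23 (`nearConstantShortTimeHL_of_dynamicsPE : MomentumClosureTightnessPQ → EnergyClosureTightnessPQ → TrueLawCapsPE →
crux`, `…EndgamePE`), whose energy K-stub S3⁗ `EnergyClosureTightnessPQ` (no speed cap, integrated QUARTIC cap) was priced FALSE at the physics level by
lead c9's wave 1 (transient giant-driver Newton cradles: linear Gibbs cost ≈ 9.4δn/θ, packing and integrated quartic caps kept, |enDefect| ≈ 2δ —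
`Cruxes/NearConstantShortTimeHL/Lines/small-tilt-domination-S3PQ-stub-false.md`), the equilibrium closure K-stubs now condition on the ball-packing cap
and the integrated EXPONENTIAL-moment cap `∫_window n⁻¹Σᵢ exp ‖vᵢ(r)‖ dr ≤ K` (`MomentumClosureTightnessPX`, `EnergyClosureTightnessPX`, `…ExpCapDefs`:
weaker statements than the PQ ones, not hit by the cradle family, whose drivers need speed ≫ n^{1/6} against the cap's O(log n)); along the TRUE law
the exponential cap is as free as the quartic one was (Tonelli + Markov from the exponential velocity moments in mean, `intExpMoment_markov`), so the
true-law input stays `TrueLawCapsPE` = ball-packing cap + super-exponential velocity tails in mean. What stays open: S2⁵ `MomentumClosureTightnessPX`,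
S3⁵ `EnergyClosureTightnessPX` (equilibrium dynamical large deviations under the invariant drifted Gibbs law, uniform rate) and S4‴ `TrueLawCapsPE`.
References: H.-T. Yau, Lett. Math. Phys. 22 (1991) §2; B. Nachtergaele – H.-T. Yau, Comm. Math. Phys. 243 (2003) §7.2.
-/

noncomputable section

namespace Summit.AtomisticToContinuum.HydrodynamicLimit.Theorems.NearConstantShortTimeHL

open Summit.AtomisticToContinuum.HydrodynamicLimit.Theses.RelayRaceLocality (NearConstantShortTimeHL)

/-- **THE CRUX FROM ITS FOUR INPUTS, EXPONENTIAL CAP** (endgame of skeleton v24): the mesoscale static superlinearity St2′, the equilibrium momentum /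
energy closure tightness under the packing and integrated exponential caps (S2⁵, S3⁵), and the packing cap plus all exponential velocity moments in
mean along the true law (S4‴). [cite: Yau1991, §2] -/
theorem nearConstantShortTimeHL_of_inputsPX : MesoscaleSuperlinearityE → MomentumClosureTightnessPX → EnergyClosureTightnessPX → TrueLawCapsPE → NearConstantShortTimeHL :=
  fun hSt2 hS2 hS3 hS4 =>
    stub_entropyToLLN (stub_meansToRelEntropy (meansConverge_of_nearConstantRelEntropy
      (stub_meansPin stub_ldaGeneralFamilies stub_concentrationGeneralFamilies
        (stub_reductionPX stub_dynamicPX hSt2 stub_uniformPressure stub_staticLLN stub_smallTiltDomination hS2 hS3 hS4))))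

/-- **THE CRUX FROM THE THREE DYNAMICAL CONJECTURES ALONE, EXPONENTIAL CAP AND SUPER-EXPONENTIAL TAILS.** With the statics side of the line closed,
the hydrodynamic-limit crux `NearConstantShortTimeHL` follows from the equilibrium momentum / energy closure tightness under the packing and integrated
exponential caps (S2⁵, S3⁵) and, along the true law, ONLY the ball-packing cap and super-exponential velocity tails in mean (S4‴) — no quartic, no
speed-cap and no Gaussian-tail a-priori input. [cite: Yau1991, §2] [cite: NachtergaeleYau2003, §7.2] -/
theorem nearConstantShortTimeHL_of_dynamicsPX :
    MomentumClosureTightnessPX → EnergyClosureTightnessPX → TrueLawCapsPE → NearConstantShortTimeHL :=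
  nearConstantShortTimeHL_of_inputsPX
    (mesoscaleSuperlinearityE_of (positionMesoscaleLD_of_densityLD mesoscaleDensityLD_holds) (stub_velocityLD stub_ballGaussianEstimate))

end Summit.AtomisticToContinuum.HydrodynamicLimit.Theorems.NearConstantShortTimeHL

end
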